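import Summits.Ventures.YMGap.FlowData.RectTubeMagneticSecant
import Summits.Ventures.YMGap.FlowData.RectTubeCouplingSecant
import HarnessLib

/-!
# Venture YMGap, track Y3 FLOW-DATA — the JOINT derivative-free Hellmann–Feynman (tangent-plane) inequality for the two-coupling
# tube operator: `(J_M'−J_M)·⟨mag⟩_Ω + (J_E'−J_E)·⟨elec⟩_Ω ≤ log ‖T_{J_E',J_M'}‖ − log ‖T_{J_E,J_M}‖`, and the KINETIC secant leg
# (theorems only)

HONEST FRAMING: venture file of the cell `pub-ymgap` (QuantumFields programme), track Y3 (FLOW-DATA), for the rectangular two-coupling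
tube operator `T_{J_E,J_M} = rectTubeTransferOperatorAniso ρ J_E J_M Ls` (`RectTubeMagneticSecant.lean`).  The FLOW-TABLE's plaquette
rows by the SECANT-CONVEX method read `P_s` from chords of `ln λ̂₀` in the plaquette coupling and `P_t` from chords in the kinetic
coupling; `RectTubeMagneticSecant` typed the magnetic leg, this file types BOTH legs at once and in particular the KINETIC one:
every chord of `(J_E, J_M) ↦ log ‖T_{J_E,J_M}‖` lies above the tangent plane at its base point whose slopes are the vacuum
expectations of the spatial plaquette sum (`mag`) and of the temporal plaquette sum (`elec`, conditionally averaged over the temporal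
links) — joint convexity + Hellmann–Feynman WITHOUT derivatives (Kingman–Jensen, `KernelRatioJensen.lean`).  A relation between
FLOW-TABLE columns on ONE finite tube; no number, no row; nothing about `L → ∞`, the continuum or a mass gap.

* `continuous_rectCondElec` (continuity of the conditional temporal expectation `⟨elec⟩_{J_E,(a,b)}`);
* **`rectAniso_log_norm_sub_ge_tangent`** — for ANY real `J_E, J_M, J_E', J_M'` and every nonnegative unit vacuum `Ω` of `T_{J_E,J_M}`:
  `‖T‖⁻¹ ∫ [(J_M'−J_M)(mag a+mag b)/2 + (J_E'−J_E)⟨elec⟩_{J_E,(a,b)}]·Ω(a)K_{J_E,J_M}(a,b)Ω(b) ≤ log ‖T_{J_E',J_M'}‖ − log ‖T_{J_E,J_M}‖`;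
  **`rectAniso_log_norm_sub_le_tangent`** (the same plane at the end point bounds the chord from above);
* the KINETIC LEG for the cell's `SU(2)` object (`J_E = β_t/2`, `J_M = β_s/2`; `Re tr = 2·½Tr`): **`su2_rectAniso_kinetic_secant_ge`** /
  **`_le`**: `(h/2)·⟨elec⟩_{Ω,β_t} ≤ ln λ₀(β_t + h, β_s) − ln λ₀(β_t, β_s) ≤ (h/2)·⟨elec⟩_{Ω',β_t+h}` — every kinetic chord slope lies
  between the temporal plaquette expectations (`N_ℓ·P_t`-type, un-normalised) at its two ends.

References: J. F. C. Kingman, Quart. J. Math. 12 (1961) 283 [cite: Kingman1961]; M. Reed, B. Simon IV (1978) §XIII.12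
[cite: ReedSimonIV1978, §XIII.12]; I. Montvay, G. Münster (1994) §3.2.6 [cite: MontvayMunster1994, §3.2.6].
-/

noncomputable section

open scoped BigOperators ENNReal RealInnerProductSpace
open MeasureTheory Filter Function
open Literature.MathematicalPhysics.QuantumFieldTheory Literature.Analysis.OperatorTheory
open Literature.MathematicalPhysics.QuantumLattice (RectTorusSite fundamentalRep continuous_fundamentalRep
  fundamentalRep_mem_unitaryGroup)

namespace Summit.Ventures.YMGap.FlowData

section Tangent

variable {G : Type*} [Group G] [TopologicalSpace G] [IsTopologicalGroup G] [CompactSpace G]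
  [MeasurableSpace G] [BorelSpace G] [SecondCountableTopology G] {n k : ℕ} (ρ : G →* Matrix (Fin n) (Fin n) ℂ)
  {Ls : Fin k → ℕ} [∀ i, NeZero (Ls i)]

/-- The conditional temporal expectation `(a,b) ↦ ⟨elec⟩_{J,(a,b)} = (∫ elec e^{J elec} dE)/(∫ e^{J elec} dE)` is continuous.
[folklore] -/
theorem continuous_rectCondElec (hρ : Continuous ρ) (J : ℝ) :
    Continuous fun z : RectSlice Ls G × RectSlice Ls G =>
      (∫ E, rectElecSum (Ls := Ls) ρ z.1 E z.2 * Real.exp (J * rectElecSum (Ls := Ls) ρ z.1 E z.2)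
          ∂(Measure.pi fun _ : RectTorusSite Ls => haarProbability G)) /
        (∫ E, Real.exp (J * rectElecSum (Ls := Ls) ρ z.1 E z.2) ∂(Measure.pi fun _ : RectTorusSite Ls => haarProbability G)) := by
  have hden := continuous_pos_integral_exp_rect (G := G) (rectElecSum (Ls := Ls) ρ) (continuous_rectElecSum ρ hρ) J
  have hnum := continuous_integral_mul_exp_rect (G := G) (rectElecSum (Ls := Ls) ρ) (continuous_rectElecSum ρ hρ) J
  exact hnum.div hden.1 fun z => (hden.2 z.1 z.2).ne'

/-- **THE TANGENT-PLANE INEQUALITY (lower chord bound)**: for any real couplings and every nonnegative unit vacuum `Ω` of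
`T_{J_E,J_M}`: `‖T_{J_E,J_M}‖⁻¹ ∫ [(J_M'−J_M)(mag a+mag b)/2 + (J_E'−J_E)⟨elec⟩_{J_E,(a,b)}] Ω(a)K_{J_E,J_M}(a,b)Ω(b) ≤
log ‖T_{J_E',J_M'}‖ − log ‖T_{J_E,J_M}‖` (continuous unitary `ρ`; no positivity of `T` used). [cite: Kingman1961] -/
theorem rectAniso_log_norm_sub_ge_tangent (hρ : Continuous ρ) (hρu : ∀ g, ρ g ∈ Matrix.unitaryGroup (Fin n) ℂ)
    (JE JM JE' JM' : ℝ) {Ω : Lp ℝ 2 (rectSliceMeasure G Ls)} (h1 : ‖Ω‖ = 1)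
    (hΩ : ∀ᵐ a ∂(rectSliceMeasure G Ls), 0 ≤ Ω a)
    (heig : rectTubeTransferOperatorAniso ρ JE JM Ls Ω = ‖rectTubeTransferOperatorAniso ρ JE JM Ls‖ • Ω) :
    ‖rectTubeTransferOperatorAniso ρ JE JM Ls‖⁻¹ *
      ∫ z, ((JM' - JM) * ((rectMagSum (Ls := Ls) ρ z.1 + rectMagSum (Ls := Ls) ρ z.2) / 2) +
          (JE' - JE) * ((∫ E, rectElecSum (Ls := Ls) ρ z.1 E z.2 * Real.exp (JE * rectElecSum (Ls := Ls) ρ z.1 E z.2)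
              ∂(Measure.pi fun _ : RectTorusSite Ls => haarProbability G)) /
            (∫ E, Real.exp (JE * rectElecSum (Ls := Ls) ρ z.1 E z.2) ∂(Measure.pi fun _ : RectTorusSite Ls => haarProbability G)))) *
        (Ω z.1 * rectSliceKernel (Ls := Ls) ρ JE JM z.1 z.2 * Ω z.2) ∂((rectSliceMeasure G Ls).prod (rectSliceMeasure G Ls)) ≤
      Real.log ‖rectTubeTransferOperatorAniso ρ JE' JM' Ls‖ - Real.log ‖rectTubeTransferOperatorAniso ρ JE JM Ls‖ := by
  have hKc := continuous_rectSliceKernel (Ls := Ls) ρ hρ JE JM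
  have hK'c := continuous_rectSliceKernel (Ls := Ls) ρ hρ JE' JM'
  obtain ⟨C, hC⟩ := exists_rectSliceKernel_le (Ls := Ls) ρ hρ JE JM
  obtain ⟨C', hC'⟩ := exists_rectSliceKernel_le (Ls := Ls) ρ hρ JE' JM'
  have hKpos := rectSliceKernel_pos (Ls := Ls) ρ hρ JE JM
  obtain ⟨R₀, R₁, hR₀, hR⟩ := exists_rectSliceKernel_ratio_bounds ρ (Ls := Ls) hρ JE JM JE' JM'
  have hmain := log_norm_sub_log_norm_ge_integral_log_ratio (μ := rectSliceMeasure G Ls) hKc.stronglyMeasurable hC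
    hK'c.stronglyMeasurable hC' hKpos hR₀ hR (rectTubeTransferOperatorAniso_ae_eq (ρ := ρ) (JE := JE) (JM := JM) (Ls := Ls) hρ)
    (rectTubeTransferOperatorAniso_ae_eq (ρ := ρ) (JE := JE') (JM := JM') (Ls := Ls) hρ)
    (norm_rectTubeTransferOperatorAniso_pos hρ) h1 hΩ heig
  refine le_trans ?_ hmain
  have hI : Integrable (fun z : RectSlice Ls G × RectSlice Ls G => Ω z.1 * (rectSliceKernel (Ls := Ls) ρ JE JM z.1 z.2 * Ω z.2))
      ((rectSliceMeasure G Ls).prod (rectSliceMeasure G Ls)) := integrable_mul_kernel_mul hKc.stronglyMeasurable hC Ω Ω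
  have hΩ1 : ∀ᵐ z ∂((rectSliceMeasure G Ls).prod (rectSliceMeasure G Ls)), 0 ≤ Ω z.1 :=
    (Measure.quasiMeasurePreserving_fst (μ := rectSliceMeasure G Ls) (ν := rectSliceMeasure G Ls)).ae hΩ
  have hΩ2 : ∀ᵐ z ∂((rectSliceMeasure G Ls).prod (rectSliceMeasure G Ls)), 0 ≤ Ω z.2 :=
    (Measure.quasiMeasurePreserving_snd (μ := rectSliceMeasure G Ls) (ν := rectSliceMeasure G Ls)).ae hΩ
  -- continuity of the tangent load
  have hm := continuous_rectMagSum (Ls := Ls) ρ hρ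
  have hq := continuous_rectCondElec ρ (Ls := Ls) hρ JE
  have hload : Continuous fun z : RectSlice Ls G × RectSlice Ls G =>
      (JM' - JM) * ((rectMagSum (Ls := Ls) ρ z.1 + rectMagSum (Ls := Ls) ρ z.2) / 2) +
        (JE' - JE) * ((∫ E, rectElecSum (Ls := Ls) ρ z.1 E z.2 * Real.exp (JE * rectElecSum (Ls := Ls) ρ z.1 E z.2)
            ∂(Measure.pi fun _ : RectTorusSite Ls => haarProbability G)) /
          (∫ E, Real.exp (JE * rectElecSum (Ls := Ls) ρ z.1 E z.2) ∂(Measure.pi fun _ : RectTorusSite Ls => haarProbability G))) :=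
    (continuous_const.mul (((hm.comp continuous_fst).add (hm.comp continuous_snd)).div_const _)).add (continuous_const.mul hq)
  obtain ⟨Bh, hBh⟩ := isCompact_univ.exists_bound_of_continuousOn hload.continuousOn
  have hlogc : AEStronglyMeasurable (fun z : RectSlice Ls G × RectSlice Ls G =>
      Real.log (rectSliceKernel (Ls := Ls) ρ JE' JM' z.1 z.2 / rectSliceKernel (Ls := Ls) ρ JE JM z.1 z.2))
      ((rectSliceMeasure G Ls).prod (rectSliceMeasure G Ls)) :=
    (Real.measurable_log.comp (hK'c.measurable.div hKc.measurable)).aestronglyMeasurable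
  have hlogb : ∀ z : RectSlice Ls G × RectSlice Ls G,
      ‖Real.log (rectSliceKernel (Ls := Ls) ρ JE' JM' z.1 z.2 / rectSliceKernel (Ls := Ls) ρ JE JM z.1 z.2)‖ ≤
        max |Real.log R₀| |Real.log R₁| := by
    intro z
    obtain ⟨hlo, hhi⟩ := hR z.1 z.2
    have hRpos : 0 < rectSliceKernel (Ls := Ls) ρ JE' JM' z.1 z.2 / rectSliceKernel (Ls := Ls) ρ JE JM z.1 z.2 :=
      lt_of_lt_of_le hR₀ hlo
    rw [Real.norm_eq_abs, abs_le]
    constructor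
    · have := Real.log_le_log hR₀ hlo
      linarith [neg_abs_le (Real.log R₀), le_max_left |Real.log R₀| |Real.log R₁|]
    · have := Real.log_le_log hRpos hhi
      linarith [le_abs_self (Real.log R₁), le_max_right |Real.log R₀| |Real.log R₁|]
  have hI' := hI.congr (Eventually.of_forall fun z =>
    show Ω z.1 * (rectSliceKernel (Ls := Ls) ρ JE JM z.1 z.2 * Ω z.2) = Ω z.1 * rectSliceKernel (Ls := Ls) ρ JE JM z.1 z.2 * Ω z.2
    by ring)
  have hi1 := hI'.bdd_mul hload.aestronglyMeasurable (Eventually.of_forall fun z => hBh z (Set.mem_univ _))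
  have hi2 := hI'.bdd_mul hlogc (Eventually.of_forall hlogb)
  refine mul_le_mul_of_nonneg_left (integral_mono_ae hi1 hi2 ?_) (inv_nonneg.2 (norm_nonneg _))
  filter_upwards [hΩ1, hΩ2] with z h1z h2z
  exact mul_le_mul_of_nonneg_right (rectAnisoLoad_le_log_ratio ρ (Ls := Ls) hρ hρu JE JM JE' JM' z)
    (mul_nonneg (mul_nonneg h1z (hKpos z.1 z.2).le) h2z)

/-- **The tangent plane at the END point bounds the chord from above**:
`log ‖T_{J_E',J_M'}‖ − log ‖T_{J_E,J_M}‖ ≤ ‖T'‖⁻¹ ∫ [(J_M'−J_M)(mag a+mag b)/2 + (J_E'−J_E)⟨elec⟩_{J_E',(a,b)}] Ω'K'Ω'` for every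
nonnegative unit vacuum `Ω'` of `T_{J_E',J_M'}`. [cite: Kingman1961] -/
theorem rectAniso_log_norm_sub_le_tangent (hρ : Continuous ρ) (hρu : ∀ g, ρ g ∈ Matrix.unitaryGroup (Fin n) ℂ)
    (JE JM JE' JM' : ℝ) {Ω' : Lp ℝ 2 (rectSliceMeasure G Ls)} (h1 : ‖Ω'‖ = 1)
    (hΩ : ∀ᵐ a ∂(rectSliceMeasure G Ls), 0 ≤ Ω' a)
    (heig : rectTubeTransferOperatorAniso ρ JE' JM' Ls Ω' = ‖rectTubeTransferOperatorAniso ρ JE' JM' Ls‖ • Ω') :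
    Real.log ‖rectTubeTransferOperatorAniso ρ JE' JM' Ls‖ - Real.log ‖rectTubeTransferOperatorAniso ρ JE JM Ls‖ ≤
      ‖rectTubeTransferOperatorAniso ρ JE' JM' Ls‖⁻¹ *
      ∫ z, ((JM' - JM) * ((rectMagSum (Ls := Ls) ρ z.1 + rectMagSum (Ls := Ls) ρ z.2) / 2) +
          (JE' - JE) * ((∫ E, rectElecSum (Ls := Ls) ρ z.1 E z.2 * Real.exp (JE' * rectElecSum (Ls := Ls) ρ z.1 E z.2)
              ∂(Measure.pi fun _ : RectTorusSite Ls => haarProbability G)) /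
            (∫ E, Real.exp (JE' * rectElecSum (Ls := Ls) ρ z.1 E z.2) ∂(Measure.pi fun _ : RectTorusSite Ls => haarProbability G)))) *
        (Ω' z.1 * rectSliceKernel (Ls := Ls) ρ JE' JM' z.1 z.2 * Ω' z.2) ∂((rectSliceMeasure G Ls).prod (rectSliceMeasure G Ls)) := by
  have h := rectAniso_log_norm_sub_ge_tangent ρ (Ls := Ls) hρ hρu JE' JM' JE JM h1 hΩ heig
  have hI : ∫ z, ((JM - JM') * ((rectMagSum (Ls := Ls) ρ z.1 + rectMagSum (Ls := Ls) ρ z.2) / 2) +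
          (JE - JE') * ((∫ E, rectElecSum (Ls := Ls) ρ z.1 E z.2 * Real.exp (JE' * rectElecSum (Ls := Ls) ρ z.1 E z.2)
              ∂(Measure.pi fun _ : RectTorusSite Ls => haarProbability G)) /
            (∫ E, Real.exp (JE' * rectElecSum (Ls := Ls) ρ z.1 E z.2) ∂(Measure.pi fun _ : RectTorusSite Ls => haarProbability G)))) *
        (Ω' z.1 * rectSliceKernel (Ls := Ls) ρ JE' JM' z.1 z.2 * Ω' z.2) ∂((rectSliceMeasure G Ls).prod (rectSliceMeasure G Ls)) =
      -∫ z, ((JM' - JM) * ((rectMagSum (Ls := Ls) ρ z.1 + rectMagSum (Ls := Ls) ρ z.2) / 2) +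
          (JE' - JE) * ((∫ E, rectElecSum (Ls := Ls) ρ z.1 E z.2 * Real.exp (JE' * rectElecSum (Ls := Ls) ρ z.1 E z.2)
              ∂(Measure.pi fun _ : RectTorusSite Ls => haarProbability G)) /
            (∫ E, Real.exp (JE' * rectElecSum (Ls := Ls) ρ z.1 E z.2) ∂(Measure.pi fun _ : RectTorusSite Ls => haarProbability G)))) *
        (Ω' z.1 * rectSliceKernel (Ls := Ls) ρ JE' JM' z.1 z.2 * Ω' z.2) ∂((rectSliceMeasure G Ls).prod (rectSliceMeasure G Ls)) := by
    rw [← integral_neg]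
    refine integral_congr_ae (Eventually.of_forall fun z => ?_)
    ring
  rw [hI, mul_neg] at h
  linarith

end Tangent

/-! ### The cell's `SU(2)` object: the KINETIC secant leg (`J_M' = J_M`) -/

section SU2

variable {k : ℕ}

/-- **Kinetic secant, lower: `(h/2)·⟨elec⟩_{Ω,(β_t,β_s)} ≤ ln λ₀(β_t+h, β_s) − ln λ₀(β_t, β_s)`** for every nonnegative unit vacuum `Ω` of
`T_{β_t/2, β_s/2}` (`⟨elec⟩_Ω = ‖T‖⁻¹ ∫ ⟨elec⟩_{β_t/2,(a,b)} Ω(a)K(a,b)Ω(b)`; in `½Tr` units the slope is the vacuum expectation of the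
temporal plaquettes of one time step, `N_ℓ·P_t`-type, un-normalised). [cite: Kingman1961] [cite: MontvayMunster1994, §3.2.6] -/
theorem su2_rectAniso_kinetic_secant_ge (βt βs h : ℝ) (Ls : Fin k → ℕ) [∀ i, NeZero (Ls i)]
    {Ω : Lp ℝ 2 (rectSliceMeasure (Matrix.specialUnitaryGroup (Fin 2) ℂ) Ls)} (h1 : ‖Ω‖ = 1)
    (hΩ : ∀ᵐ a ∂(rectSliceMeasure (Matrix.specialUnitaryGroup (Fin 2) ℂ) Ls), 0 ≤ Ω a)
    (heig : rectTubeTransferOperatorAniso (fundamentalRep (Fin 2)) (βt / 2) (βs / 2) Ls Ω =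
      ‖rectTubeTransferOperatorAniso (fundamentalRep (Fin 2)) (βt / 2) (βs / 2) Ls‖ • Ω) :
    ‖rectTubeTransferOperatorAniso (fundamentalRep (Fin 2)) (βt / 2) (βs / 2) Ls‖⁻¹ *
      ∫ z, ((h / 2) * ((∫ E, rectElecSum (Ls := Ls) (fundamentalRep (Fin 2)) z.1 E z.2 *
                Real.exp (βt / 2 * rectElecSum (Ls := Ls) (fundamentalRep (Fin 2)) z.1 E z.2)
              ∂(Measure.pi fun _ : RectTorusSite Ls => haarProbability (Matrix.specialUnitaryGroup (Fin 2) ℂ))) /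
            (∫ E, Real.exp (βt / 2 * rectElecSum (Ls := Ls) (fundamentalRep (Fin 2)) z.1 E z.2)
              ∂(Measure.pi fun _ : RectTorusSite Ls => haarProbability (Matrix.specialUnitaryGroup (Fin 2) ℂ))))) *
        (Ω z.1 * rectSliceKernel (Ls := Ls) (fundamentalRep (Fin 2)) (βt / 2) (βs / 2) z.1 z.2 * Ω z.2)
        ∂((rectSliceMeasure (Matrix.specialUnitaryGroup (Fin 2) ℂ) Ls).prod
          (rectSliceMeasure (Matrix.specialUnitaryGroup (Fin 2) ℂ) Ls)) ≤
      Real.log ‖rectTubeTransferOperatorAniso (fundamentalRep (Fin 2)) ((βt + h) / 2) (βs / 2) Ls‖ -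
        Real.log ‖rectTubeTransferOperatorAniso (fundamentalRep (Fin 2)) (βt / 2) (βs / 2) Ls‖ := by
  haveI : SecondCountableTopology (Matrix.specialUnitaryGroup (Fin 2) ℂ) :=
    Literature.MathematicalPhysics.QuantumLattice.secondCountableTopology_su2
  have hh := rectAniso_log_norm_sub_ge_tangent (fundamentalRep (Fin 2)) (Ls := Ls) (continuous_fundamentalRep (Fin 2))
    fundamentalRep_mem_unitaryGroup (βt / 2) (βs / 2) ((βt + h) / 2) (βs / 2) h1 hΩ heig
  refine le_trans (le_of_eq ?_) hh
  congr 1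
  refine integral_congr_ae (Eventually.of_forall fun z => ?_)
  dsimp only
  ring

/-- **Kinetic secant, upper: `ln λ₀(β_t+h, β_s) − ln λ₀(β_t, β_s) ≤ (h/2)·⟨elec⟩_{Ω',(β_t+h,β_s)}`** for every nonnegative unit vacuum `Ω'`
of `T_{(β_t+h)/2, β_s/2}`. [cite: Kingman1961] [cite: MontvayMunster1994, §3.2.6] -/
theorem su2_rectAniso_kinetic_secant_le (βt βs h : ℝ) (Ls : Fin k → ℕ) [∀ i, NeZero (Ls i)]
    {Ω' : Lp ℝ 2 (rectSliceMeasure (Matrix.specialUnitaryGroup (Fin 2) ℂ) Ls)} (h1 : ‖Ω'‖ = 1)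
    (hΩ : ∀ᵐ a ∂(rectSliceMeasure (Matrix.specialUnitaryGroup (Fin 2) ℂ) Ls), 0 ≤ Ω' a)
    (heig : rectTubeTransferOperatorAniso (fundamentalRep (Fin 2)) ((βt + h) / 2) (βs / 2) Ls Ω' =
      ‖rectTubeTransferOperatorAniso (fundamentalRep (Fin 2)) ((βt + h) / 2) (βs / 2) Ls‖ • Ω') :
    Real.log ‖rectTubeTransferOperatorAniso (fundamentalRep (Fin 2)) ((βt + h) / 2) (βs / 2) Ls‖ -
        Real.log ‖rectTubeTransferOperatorAniso (fundamentalRep (Fin 2)) (βt / 2) (βs / 2) Ls‖ ≤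
      ‖rectTubeTransferOperatorAniso (fundamentalRep (Fin 2)) ((βt + h) / 2) (βs / 2) Ls‖⁻¹ *
      ∫ z, ((h / 2) * ((∫ E, rectElecSum (Ls := Ls) (fundamentalRep (Fin 2)) z.1 E z.2 *
                Real.exp ((βt + h) / 2 * rectElecSum (Ls := Ls) (fundamentalRep (Fin 2)) z.1 E z.2)
              ∂(Measure.pi fun _ : RectTorusSite Ls => haarProbability (Matrix.specialUnitaryGroup (Fin 2) ℂ))) /
            (∫ E, Real.exp ((βt + h) / 2 * rectElecSum (Ls := Ls) (fundamentalRep (Fin 2)) z.1 E z.2)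
              ∂(Measure.pi fun _ : RectTorusSite Ls => haarProbability (Matrix.specialUnitaryGroup (Fin 2) ℂ))))) *
        (Ω' z.1 * rectSliceKernel (Ls := Ls) (fundamentalRep (Fin 2)) ((βt + h) / 2) (βs / 2) z.1 z.2 * Ω' z.2)
        ∂((rectSliceMeasure (Matrix.specialUnitaryGroup (Fin 2) ℂ) Ls).prod
          (rectSliceMeasure (Matrix.specialUnitaryGroup (Fin 2) ℂ) Ls)) := by
  haveI : SecondCountableTopology (Matrix.specialUnitaryGroup (Fin 2) ℂ) :=
    Literature.MathematicalPhysics.QuantumLattice.secondCountableTopology_su2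
  have hh := rectAniso_log_norm_sub_le_tangent (fundamentalRep (Fin 2)) (Ls := Ls) (continuous_fundamentalRep (Fin 2))
    fundamentalRep_mem_unitaryGroup (βt / 2) (βs / 2) ((βt + h) / 2) (βs / 2) h1 hΩ heig
  refine le_trans hh (le_of_eq ?_)
  congr 1
  refine integral_congr_ae (Eventually.of_forall fun z => ?_)
  dsimp only
  ring

end SU2

end Summit.Ventures.YMGap.FlowData
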